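import Mathlib
import Summits.KontsevichZagierPeriods.Zeta5Search.LaiBoxInputs
import Summits.KontsevichZagierPeriods.Zeta5Search.LaiPhiTilde
import Summits.KontsevichZagierPeriods.Zeta5Search.LaiGrowthRate
import Summits.KontsevichZagierPeriods.Zeta5Search.LaiDecayKappa3
import Summits.KontsevichZagierPeriods.Zeta5Search.LaiDecayAlpha
import HarnessLib

/-!
# ζ(5) search — the κ₃ ladder point assembled: `LaiBoxInputs 74 2180 444 δ74 36` CONDITIONAL ON THE SAVING
# RATE ONLY (fam-indep, generation 5 capstone)

HONEST FRAMING: systematic search; no irrationality claim unless certified. THIS FILE IS NOT A CERTIFICATE.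
It proves a CONDITIONAL theorem and names exactly what was still open when it was written (generation 5); see STATUS
below — both remaining inputs have since been discharged downstream by the kernel-checked sweep certificate.

Cell `pub-zeta5` (summit KontsevichZagierPeriods, topic Zeta5Search), family `indep` (LINEAR-INDEPENDENCE / DIMENSION
route), generation 5. The κ₃ skeleton `LaiBoxInputs J r M δ m` (tree `LaiBoxInputs.lean`, with the PROVED reading
`LaiBoxInputs.three_le_oddZetaSpanRank : 1 ≤ m → LaiBoxInputs J r M δ m → 3 ≤ oddZetaSpanRank m`, i.e.
`dim_ℚ Span_ℚ(1, ζ(3), …, ζ(2m+1)) ≥ 3`) has 21 fields. At the fam-indep ladder CANDIDATE point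
`(J, r, M, δ, m) = (74, 2180, 444, δ74, 36)` the chain `LaiBricks → … → LaiDecayAlpha` made all of them theorems
EXCEPT the saving rate:

* arithmetic `coef, hasSum, C, Dm, Φ, Φ_pos, c, isInt, dvd3` — `LaiBrickCoefficients`, `LaiDenominators`,
  `LaiSaving`, `LaiPhiTilde` (for ANY admissible exponent table `e`, `Φ := laiPhiGen 74 444 5 e`; Lai's closed-form
  table `laiPhiMin` is admissible, `laiPhiMin_admissible`);
* `β := kappa3Beta`, `growth` and the enclosure `53066.168 ≤ β ≤ 53066.1682` — `LaiGrowthRate`;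
* `α := (kappa3DecayInputs δ74 _).alpha = −max_{x > 2180} f(x)`, `decay` — `LaiDecaySplit … LaiDecayKappa3`, and the
  kernel enclosure `38725.5 ≤ α` — `LaiDecayAlpha`;
* hence the three numeric inequalities `decay_pos`, `growth_pos`, `margin` reduce to LINEAR ARITHMETIC in the
  saving rate `ϖ`: they hold as soon as `38700 ≤ ϖ ≤ 80000` (`margin` ⇔ `2ϖ > β + 2·32178 − 3·439 − α`, and
  `β − α ≤ 53066.1682 − 38725.5`; slack `> 20` nats at `ϖ = 38700`).

So: **`kappa3LaiBoxInputs`** — for every admissible table `e` and every real `ϖ` with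
`log (laiPhiGen 74 444 5 e n) / n → ϖ` and `38700 ≤ ϖ ≤ 80000`, an inhabitant of `LaiBoxInputs 74 2180 444 δ74 36`;
**`kappa3_three_le_oddZetaSpanRank_of_savingRate`** — under the same two hypotheses, `3 ≤ oddZetaSpanRank 36`
('κ₃ ≤ 73'); and the specialisation to Lai's table `Φ̃ = laiPhiTilde` (`…_phiTilde`).

WHAT REMAINS OPEN (and is NOT claimed): (i) the EXISTENCE of the saving rate `ϖ = lim (1/n) log Φ_n` for the chosen
table (PNT over the classes `{n/p} ∈ [u,v)`: the tree has the one-class rate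
`Literature…RhinViola.tendsto_sum_log_prime_fract_div_cutoff`; the table must first be shown to be a step function of
`{n/p}` with finitely many pieces — note that the grid minimum `laiPhiMin` and the real-variable minimum of
`φ̃(x, ·)` can differ by one on the piece right of `y ≡ (r+M)x`, so the successor should fix the table before the rate);
(ii) its ENCLOSURE: Lai's value for the real-minimum table is `ϖ̃ = 38764.19…` ([Lai2024BallRivoal, §13]; this cell's
331 852-interval evaluation, KAPPA3.md §7), 64 nats above the threshold `38700` used here; a grid-minimum table has a
rate `≥` that. At generation 5, with (i)–(ii) not yet theorems of this tree, 'κ₃ ≤ 73' was a MANUSCRIPT-LEVEL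
CANDIDATE of a systematic search. STATUS: (i)–(ii) ARE NOW DISCHARGED in this tree for a finite cell table dominated
by Lai's — existence and value of the rate of any finite cell table (`tendsto_log_laiPhiGen_cellExp_div`,
`LaiSavingCells.lean`), the reduction to ONE finite certificate (`Kappa3CellCert`, `LaiKappa3Cells.lean`), and the
certificate itself, produced data-free by the order-cell sweep and checked by `decide +kernel` (`Sweep.kappa3SweepCert`:
889 shards, 71 020 cells, certified truncated rate `Σ Lo / 2^40 = 38729.67 ≥ 38700`; `LaiSweepEngine …
LaiKappa3SweepCert.lean`) — whence the hypothesis-free `Sweep.kappa3_sweep_three_le_oddZetaSpanRank :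
3 ≤ oddZetaSpanRank 36`. The theorems of THIS file remain the conditional assembly that chain instantiates; the
dimension statement concerns linear independence only and says nothing about `ζ(5)` itself.

References: [Lai2024BallRivoal] L. Lai, arXiv:2407.14236, §4, §13; [FischlerZudilin2010] S. Fischler, W. Zudilin,
Math. Ann. 347 (2010), Thm 2 (the dimension criterion behind `three_le_oddZetaSpanRank`).
-/

noncomputable section

open Finset Filter Topology

namespace Summit.KontsevichZagierPeriods.Zeta5Search

open LaiBoxUnimodal (delta74)

set_option maxRecDepth 20000 in
/-- The block profile of `LaiPhiTilde.δ74` is the list `LaiBoxUnimodal.delta74`. [this file] -/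
theorem ofFn_δ74 : List.ofFn δ74 = delta74 := by decide

/-- `Σ_j Dm_j = Σ_j max(434, 444 − δ_j) = 32178` over `ℝ`. [this file] -/
theorem sum_Dm74_real : (∑ j : Fin 74, ((max (444 - 2 * 5) (444 - δ74 j) : ℕ) : ℝ)) = 32178 := by
  have h := sum_Dm74
  exact_mod_cast h

/-- The linear arithmetic of the three numeric fields: with `α ≥ 38725.5`, `53066.168 ≤ β ≤ 53066.1682` and
`38700 ≤ ϖ ≤ 80000`, `decay_pos`, `growth_pos` and `margin` hold at `S = 32178`, `c = 439`. [this file] -/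
theorem kappa3_numerics {α β ϖ : ℝ} (hα : (38725 : ℝ) + 1 / 2 ≤ α)
    (hβ : (53066168 / 1000 : ℝ) ≤ β ∧ β ≤ (530661682 / 10000 : ℝ)) (hlo : (38700 : ℝ) ≤ ϖ) (hhi : ϖ ≤ 80000) :
    (32178 : ℝ) - ϖ < α ∧ ϖ - 32178 < β ∧ β + 32178 - ϖ < α + ϖ - 32178 + 3 * ((439 : ℕ) : ℝ) := by
  obtain ⟨hβ1, hβ2⟩ := hβ
  refine ⟨by linarith, by linarith, ?_⟩
  push_cast
  linarith

/-- **The κ₃ ladder point assembled, CONDITIONAL on the saving rate.** For every admissible exponent table `e`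
(`Φ := laiPhiGen 74 444 5 e`) and every `ϖ` with `(1/n) log Φ_n → ϖ` and `38700 ≤ ϖ ≤ 80000`: an inhabitant of
`LaiBoxInputs 74 2180 444 δ74 36`. Every other field is a theorem of the chain `LaiBricks … LaiDecayAlpha`.
NOT a certificate: hypotheses (i) rate existence, (ii) enclosure are OPEN in this tree. [this file] -/
def kappa3LaiBoxInputs (e : ℕ → ℕ → ℕ) (he : LaiExpAdmissible 74 2180 444 δ74 5 e) (ϖ : ℝ)
    (hrate : Tendsto (fun n : ℕ => Real.log ((laiPhiGen 74 444 5 e n : ℕ) : ℝ) / n) atTop (𝓝 ϖ))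
    (hlo : (38700 : ℝ) ≤ ϖ) (hhi : ϖ ≤ 80000) : LaiBoxInputs 74 2180 444 δ74 36 where
  hJ := by norm_num
  coef := laiCoef 74 444 kappa3Coef
  hasSum := kappa3_hasSum
  C := fun n => laiC 74 2180 444 n δ74
  Dm := fun j => max (444 - 2 * 5) (444 - δ74 j)
  Φ := laiPhiGen 74 444 5 e
  Φ_pos := laiPhiGen_pos 74 444 5 e
  c := 439
  isInt := fun n s => by
    have h := laiCoef_isInt_phi 74 2180 444 δ74 two_mul_δ74_le (by norm_num) δ74_monotone kappa3Coef
      kappa3Coef_spec 5 five_le_δ74 (by norm_num) e he n s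
    simp only [normaliser, blockDenom]
    exact h
  dvd3 := fun n s hs => by
    have h := laiCoef_dvd3_phi 74 2180 444 δ74 two_mul_δ74_le (by norm_num) δ74_monotone (by norm_num)
      kappa3Coef kappa3Coef_spec 5 five_le_δ74 (by norm_num) e he n s hs
    have e2 : 444 - δ74 ⟨2, by norm_num⟩ = 439 := by rw [δ74_two]
    rw [e2] at h
    simp only [normaliser, blockDenom]
    exact h
  α := (kappa3DecayInputs δ74 ofFn_δ74).alpha
  decay := kappa3_decay δ74 ofFn_δ74
  ϖ := ϖ
  savingRate := hrate
  β := kappa3Beta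
  growth := kappa3_growth
  decay_pos := by
    rw [sum_Dm74_real]
    exact (kappa3_numerics (kappa3_alpha_ge ofFn_δ74 (kappa3DecayInputs δ74 ofFn_δ74)) kappa3Beta_bounds
      hlo hhi).1
  growth_pos := by
    rw [sum_Dm74_real]
    exact (kappa3_numerics (kappa3_alpha_ge ofFn_δ74 (kappa3DecayInputs δ74 ofFn_δ74)) kappa3Beta_bounds
      hlo hhi).2.1
  margin := by
    rw [sum_Dm74_real]
    exact (kappa3_numerics (kappa3_alpha_ge ofFn_δ74 (kappa3DecayInputs δ74 ofFn_δ74)) kappa3Beta_bounds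
      hlo hhi).2.2

/-- **'κ₃ ≤ 73' CONDITIONAL on the saving rate**: for every admissible table `e` and every `ϖ ∈ [38700, 80000]`
with `(1/n) log (laiPhiGen 74 444 5 e n) → ϖ`, `dim_ℚ Span_ℚ(1, ζ(3), ζ(5), …, ζ(73)) ≥ 3`. The two hypotheses are
genuine hypotheses HERE; both are discharged downstream (`Sweep.kappa3_sweep_three_le_oddZetaSpanRank`, via
`LaiKappa3Cells` and the sweep certificate `Sweep.kappa3SweepCert`). [this file] -/
theorem kappa3_three_le_oddZetaSpanRank_of_savingRate (e : ℕ → ℕ → ℕ)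
    (he : LaiExpAdmissible 74 2180 444 δ74 5 e) (ϖ : ℝ)
    (hrate : Tendsto (fun n : ℕ => Real.log ((laiPhiGen 74 444 5 e n : ℕ) : ℝ) / n) atTop (𝓝 ϖ))
    (hlo : (38700 : ℝ) ≤ ϖ) (hhi : ϖ ≤ 80000) : 3 ≤ oddZetaSpanRank 36 :=
  (kappa3LaiBoxInputs e he ϖ hrate hlo hhi).three_le_oddZetaSpanRank (by norm_num)

/-- The same with Lai's closed-form saving factor `Φ̃ = laiPhiTilde 74 2180 444 δ74 5` (table `laiPhiMin`,
admissible by `laiPhiMin_admissible`). CONDITIONAL; no claim. [this file] -/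
theorem kappa3_three_le_oddZetaSpanRank_phiTilde (ϖ : ℝ)
    (hrate : Tendsto (fun n : ℕ => Real.log ((laiPhiTilde 74 2180 444 δ74 5 n : ℕ) : ℝ) / n) atTop (𝓝 ϖ))
    (hlo : (38700 : ℝ) ≤ ϖ) (hhi : ϖ ≤ 80000) : 3 ≤ oddZetaSpanRank 36 :=
  kappa3_three_le_oddZetaSpanRank_of_savingRate _ (laiPhiMin_admissible 74 2180 444 δ74 5) ϖ
    (by simpa only [laiPhiTilde] using hrate) hlo hhi

/-- Ladder reading: under the same hypotheses `dim_ℚ Span_ℚ(1, ζ(3), …, ζ(2m'+1)) ≥ 3` for every `m' ≥ 36`.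
CONDITIONAL; no claim. [this file] -/
theorem kappa3_three_le_oddZetaSpanRank_le (e : ℕ → ℕ → ℕ) (he : LaiExpAdmissible 74 2180 444 δ74 5 e) (ϖ : ℝ)
    (hrate : Tendsto (fun n : ℕ => Real.log ((laiPhiGen 74 444 5 e n : ℕ) : ℝ) / n) atTop (𝓝 ϖ))
    (hlo : (38700 : ℝ) ≤ ϖ) (hhi : ϖ ≤ 80000) {m' : ℕ} (hm' : 36 ≤ m') : 3 ≤ oddZetaSpanRank m' :=
  (kappa3LaiBoxInputs e he ϖ hrate hlo hhi).three_le_oddZetaSpanRank_le (by norm_num) hm'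

end Summit.KontsevichZagierPeriods.Zeta5Search
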